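import Mathlib.Analysis.SpecialFunctions.Pow.Complex
import Mathlib.Analysis.Complex.ExponentialBounds
import Literature.Barriers.Parity.SiegelZeroPrimePairsPairSum
import Literature.NumberTheory.LFunctions.PagePNTWithExceptionalZero
import Literature.NumberTheory.LFunctions.ZetaRealAxis
import HarnessLib

/-!
# Goldston–Suriajaya, Theorem 2, proved from the prime number theorem for progressions
# with the exceptional-zero term

Sibling of `Literature/Barriers/Parity/SiegelZeroPrimePairs.lean`. Everything in this file is
PROVED; the main result is

* `Literature.Barriers.Parity.SiegelZeroPrimePairBarrier_of_pagePNT :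
    Literature.NumberTheory.LFunctions.PagePNTWithExceptionalZero → SiegelZeroPrimePairBarrier`

— Goldston–Suriajaya (arXiv:2104.09407), Theorem 2 ("Theorem 1 holds if we replace the Weak
Hardy–Littlewood Goldbach Conjecture with the Hardy–Littlewood Prime-Pair Upper Bound
Conjecture": the conjectured bound `ψ₂(x, k) ≤ (2 − δ)𝔖(k)(x − k) + o(𝔖(k)x)` uniformly for even
`2 ≤ k ≤ x` forces `β₁ < 1 − C(δ)/log²q` for real zeros `β₁ > 1 − c/log q` of real `L(s, χ)`
mod `q`, `q` large), CONDITIONAL only on the tree's named fact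
`Literature.NumberTheory.LFunctions.PagePNTWithExceptionalZero` = Montgomery–Vaughan Cor. 11.17
(11.29), which is exactly the input "(PNTAP)" the source takes from [MontgomeryVaughan2007] in
its §4. So the trust base of the barrier `SiegelZeroPrimePairBarrier` is reduced to (11.29).

## The argument (GS21 §§4, 5, 7, with a sharp cutoff)

Let `c, c₁, K` be the constants of (11.29) and put `c' = min(c, 1)`; the barrier holds with
`c'/3`. Given `0 < δ < 1` and the conjecture, let `A = 4/c₁²`, `C = δ/(8(A + 5))`, `η = δ/16`
(with the conjecture's threshold `x₀(η)`), and let `q` be large (`q > max(3, x₀, 48K/δ, 256/δ)`).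
Suppose `χ` mod `q` is quadratic, `1 − c'/(3 log q) < β < 1`, `L(β, χ) = 0` and, for
contradiction, `β ≥ 1 − C/log²q`.

1. `χ ≠ χ₀`: `L(β, χ₀) = ζ(β)∏_{p∣q}(1 − p^{−β}) ≠ 0` for `0 < β < 1` (tree:
   `Literature.NumberTheory.LFunctions.riemannZeta_ofReal_ne_zero_of_pos_of_lt_one`).
2. Pass to the EVEN modulus `q' = 2q` and the induced character `χ'` (Mathlib `changeLevel`):
   `χ' ≠ 1` is quadratic, `L(β, χ') = L(β, χ)·∏(1 − χ(p)p^{−β}) = 0`, and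
   `β > 1 − c/log(4q')` since `log 8q ≤ 3 log q` (`q ≥ 3`); so (11.29) applies mod `q'`:
   `ψ(X; q', b) = X/φ(q') − χ'(b)X^β/(φ(q')β) + E_b`, `|E_b| ≤ KX e^{−c₁√log X}` (GS21 (PNTAP)).
3. Take `X = q^m`, `m = ⌈A log q⌉ + 4`, so `log X ≥ A log²q` (i.e. `e^{−c₁√log X} ≤ q^{−2}`:
   GS21's choice `log N = (log q/c'')²`), `X ≥ q⁴`, and `2(1 − β)log X ≤ 2Cm/log q ≤ δ/4`.
4. Second evaluation (GS21 (Tq4), `𝒯(q) = N²/φ(q) + Γ(β₁)²N^{2β₁}/φ(q) + O(N²e^{−c₁√log N})`):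
   summing the squares over the reduced classes and using `∑_b χ'(b) = 0`,
   `∑_b ψ(X; q', b)² ≥ (X² + X^{2β})/φ(q') − 6KX²e^{−c₁√log X} ≥ (2 − δ/4 − δ/4)X²/φ(q')`
   (`residueSquareSum_ge`; `X^{2β−2} ≥ e^{−δ/4} ≥ 1 − δ/4`).
5. First evaluation (`Literature.Barriers.Parity.GoldstonSuriajaya.residueSquareSum_le`, GS21
   (Tqbound)): `∑_b ψ(X; q', b)² ≤ (X+1)log²X + (2 − δ + 2η)X²/φ(q') ≤ (δ/4 + 2 − δ + δ/8)X²/φ(q')`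
   (`(X+1)log²X ≤ 32X^{3/2}` and `√X ≥ q²`).
6. `2 − δ/2 ≤ 2 − 5δ/8` is absurd (GS21 (key): `Γ(β₁)²N^{2(β₁−1)} ≤ 1 − δ + o(1)`).

The sharp cutoff replaces GS21's power-series weights `r^{n+n'}` (for prime pairs the square
`{n, n' ≤ X}` is exactly what `∑_b ψ(X; q', b)²` counts) and the passage to `2q` replaces their
estimate (Psi2_k_odd) for odd shifts; Gamma factors do not arise. The constants differ from the
printed `C(δ) = ½(c')²log(1/(1−δ))` (Theorem 3), which the barrier statement does not assert.

## References

* D. A. Goldston, A. I. Suriajaya, *Note on the Goldbach conjecture and Landau–Siegel zeros*,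
  arXiv:2104.09407 (2021): Theorems 1–3, §4 (PNTAP)–(Sq4), §5 (key), §7 (Tqbound), (Tq4).
  [cite: GoldstonSuriajaya2021, Theorem 2 and §7]
* H. L. Montgomery, R. C. Vaughan, *Multiplicative Number Theory I*, CUP 2007, Cor. 11.17 (11.29)
  (tree: `Literature.NumberTheory.LFunctions.PagePNTWithExceptionalZero`). [cite: MontgomeryVaughan2007, Corollary 11.17 (11.29)]
-/

noncomputable section

open Finset Real
open scoped ArithmeticFunction.vonMangoldt

namespace Literature.Barriers.Parity

namespace GoldstonSuriajaya

open Literature.NumberTheory.Sieve Literature.NumberTheory.LFunctions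

/-! ### Step 1: the principal `L`-function has no zeros in `(0, 1)` -/

/-- `L(β, χ₀) = ζ(β)∏_{p ∣ q}(1 − p^{−β}) ≠ 0` for `0 < β < 1` (`ζ(β) < 0` there). [folklore] -/
theorem LFunction_one_ne_zero_of_pos_of_lt_one (q : ℕ) [NeZero q] {β : ℝ} (h0 : 0 < β)
    (h1 : β < 1) : (1 : DirichletCharacter ℂ q).LFunction β ≠ 0 := by
  have hβ1 : (β : ℂ) ≠ 1 := by
    intro h
    have := congrArg Complex.re h
    rw [Complex.ofReal_re, Complex.one_re] at this
    linarith
  change DirichletCharacter.LFunctionTrivChar q β ≠ 0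
  rw [DirichletCharacter.LFunctionTrivChar_eq_mul_riemannZeta hβ1]
  refine mul_ne_zero (prod_ne_zero_iff.mpr fun p hp => ?_)
    (riemannZeta_ofReal_ne_zero_of_pos_of_lt_one β h0 h1)
  have hp2 : 2 ≤ p := (Nat.prime_of_mem_primeFactors hp).two_le
  have hlt : (p : ℝ) ^ (-β) < 1 :=
    Real.rpow_lt_one_of_one_lt_of_neg (by exact_mod_cast hp2) (by linarith)
  have hcast : (p : ℂ) ^ (-(β : ℂ)) = (((p : ℝ) ^ (-β) : ℝ) : ℂ) := by
    rw [Complex.ofReal_cpow (Nat.cast_nonneg _), Complex.ofReal_neg, Complex.ofReal_natCast]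
  rw [hcast, sub_ne_zero]
  intro h
  have := congrArg Complex.re h
  rw [Complex.one_re, Complex.ofReal_re] at this
  linarith

/-! ### Step 4: the lower bound for `∑_b ψ(X; q, b)²` from the exceptional-zero PNT -/

/-- `∑_{b mod q} Re χ(b) = 0` for `χ ≠ χ₀`. [folklore] -/
theorem sum_re_apply_eq_zero {q : ℕ} [NeZero q] {χ : DirichletCharacter ℂ q} (hχ1 : χ ≠ 1) :
    ∑ b : ZMod q, (χ b).re = 0 := by
  rw [← Complex.re_sum, MulChar.sum_eq_zero_of_ne_one hχ1, Complex.zero_re]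

/-- A quadratic character takes the values `±1` on units. [folklore] -/
theorem re_apply_unit {q : ℕ} [NeZero q] {χ : DirichletCharacter ℂ q} (hχ : χ.IsQuadratic)
    {b : ZMod q} (hb : IsUnit b) : (χ b).re = 1 ∨ (χ b).re = -1 := by
  rcases hχ b with h | h | h
  · exact absurd h (hb.map χ).ne_zero
  · left
    rw [h, Complex.one_re]
  · right
    rw [h, Complex.neg_re, Complex.one_re]

/-- `∑_{b mod q} 𝟙_{(b,q)=1} x = φ(q) x`. [folklore] -/
theorem sum_ite_isUnit_const {q : ℕ} [NeZero q] (x : ℝ) :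
    ∑ b : ZMod q, (if IsUnit b then x else 0) = Nat.totient q * x := by
  rw [← sum_filter]
  have hset : (univ : Finset (ZMod q)).filter IsUnit =
      (univ : Finset (ZMod q)ˣ).map ⟨Units.val, Units.val_injective⟩ := by
    ext b
    simp only [mem_filter, mem_univ, true_and, mem_map, Function.Embedding.coeFn_mk]
    constructor
    · rintro ⟨u, hu⟩
      exact ⟨u, hu⟩
    · rintro ⟨u, hu⟩
      exact ⟨u, hu⟩
  rw [hset, sum_map, sum_const, card_univ, ZMod.card_units_eq_totient, nsmul_eq_mul]

/-- One class: if `|ψ − M + εS| ≤ E` with `ε = ±1`, `M, S ≥ 0`, then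
`ψ² ≥ (M − εS)² − 2(M + S)E = M² + S² − 2(M+S)E − 2MSε`. [folklore] -/
theorem sq_lower_of_abs_le {ψ M S E ε : ℝ} (hM : 0 ≤ M) (hS : 0 ≤ S) (hε : ε = 1 ∨ ε = -1)
    (h : |ψ - M + ε * S| ≤ E) :
    (M ^ 2 + S ^ 2 - 2 * ((M + S) * E)) - 2 * (M * S) * ε ≤ ψ ^ 2 := by
  obtain ⟨h1, h2⟩ := abs_le.mp h
  rcases hε with rfl | rfl
  · nlinarith [mul_nonneg hM (by linarith : (0 : ℝ) ≤ ψ - M + 1 * S + E),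
      mul_nonneg hS (by linarith : (0 : ℝ) ≤ E - (ψ - M + 1 * S)), sq_nonneg (ψ - M + 1 * S)]
  · nlinarith [mul_nonneg hM (by linarith : (0 : ℝ) ≤ ψ - M + -1 * S + E),
      mul_nonneg hS (by linarith : (0 : ℝ) ≤ ψ - M + -1 * S + E), sq_nonneg (ψ - M + -1 * S)]

/-- **GS21 (Tq4), sharp form, as a lower bound.** If `χ ≠ χ₀` is quadratic mod `q` and
`|ψ(X; q, b) − M + χ(b)S| ≤ E` for every reduced class `b` (`M, S ≥ 0`), then
`∑_b ψ(X; q, b)² ≥ φ(q)(M² + S² − 2(M + S)E)`: expand `(M − χ(b)S)²` and use `∑_b χ(b) = 0`,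
`χ(b)² = 1` ("noting the term with `χ₁(b)` vanishes when summed").
[cite: GoldstonSuriajaya2021, §7 (Tq4)] -/
theorem residueSquareSum_ge {q : ℕ} [NeZero q] {χ : DirichletCharacter ℂ q} (hχ1 : χ ≠ 1)
    (hχ : χ.IsQuadratic) (X : ℕ) {M S E : ℝ} (hM : 0 ≤ M) (hS : 0 ≤ S)
    (happrox : ∀ b : ZMod q, IsUnit b →
      |ParityWave0.chebyshevPsiMod q b X - M + (χ b).re * S| ≤ E) :
    (Nat.totient q : ℝ) * (M ^ 2 + S ^ 2 - 2 * ((M + S) * E)) ≤ residueSquareSum q X := by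
  have hterm : ∀ b ∈ (univ : Finset (ZMod q)),
      (if IsUnit b then M ^ 2 + S ^ 2 - 2 * ((M + S) * E) else 0) - 2 * (M * S) * (χ b).re ≤
        ParityWave0.chebyshevPsiMod q b X ^ 2 := by
    intro b _
    by_cases hb : IsUnit b
    · rw [if_pos hb]
      exact sq_lower_of_abs_le hM hS (re_apply_unit hχ hb) (happrox b hb)
    · rw [if_neg hb, MulChar.map_nonunit χ hb, Complex.zero_re, mul_zero, sub_zero]
      positivity
  have hsum := Finset.sum_le_sum hterm
  rw [sum_sub_distrib, sum_ite_isUnit_const, ← mul_sum, sum_re_apply_eq_zero hχ1, mul_zero,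
    sub_zero] at hsum
  exact hsum

/-! ### Two elementary estimates -/

/-- `(X + 1)log²X ≤ 32 X√X` for `X ≥ 1` (from `log X ≤ 4X^{1/4}`). [folklore] -/
theorem add_one_mul_log_sq_le {X : ℝ} (hX : 1 ≤ X) :
    (X + 1) * Real.log X ^ 2 ≤ 32 * X * Real.sqrt X := by
  have hX0 : 0 ≤ X := zero_le_one.trans hX
  have h4 := Real.log_le_rpow_div hX0 (by norm_num : (0 : ℝ) < 1 / 4)
  have hroot : X ^ (1 / 4 : ℝ) = Real.sqrt (Real.sqrt X) := by
    rw [Real.sqrt_eq_rpow, Real.sqrt_eq_rpow, ← Real.rpow_mul hX0]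
    norm_num
  have ht0 : 0 ≤ Real.sqrt (Real.sqrt X) := Real.sqrt_nonneg _
  have hlog0 : 0 ≤ Real.log X := Real.log_nonneg hX
  have hlog : Real.log X ≤ 4 * Real.sqrt (Real.sqrt X) := by
    rw [hroot] at h4
    linarith
  have htt : Real.sqrt (Real.sqrt X) * Real.sqrt (Real.sqrt X) = Real.sqrt X :=
    Real.mul_self_sqrt (Real.sqrt_nonneg X)
  have hsq : Real.log X ^ 2 ≤ 16 * Real.sqrt X := by
    nlinarith [mul_le_mul hlog hlog hlog0 (by linarith)]
  have hs0 : 0 ≤ Real.sqrt X := Real.sqrt_nonneg X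
  nlinarith [mul_le_mul_of_nonneg_left hsq (by linarith : (0 : ℝ) ≤ X + 1)]

/-- `(X^β)² ≥ (1 − t)X²` as soon as `2 log X · (1 − β) ≤ t` (`X ≥ 1`, `β ≤ 1`): the exceptional
term `N^{2(β₁−1)} = e^{−2(1−β₁)log N} ≥ 1 − 2(1−β₁)log N`. [cite: GoldstonSuriajaya2021, §5 (key)] -/
theorem rpow_sq_ge {X β t : ℝ} (hX : 1 ≤ X) (ht : 2 * Real.log X * (1 - β) ≤ t) :
    (1 - t) * X ^ 2 ≤ (X ^ β) ^ 2 := by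
  have hX0 : 0 < X := by linarith
  rw [Real.rpow_def_of_pos hX0]
  have hX2 : X ^ 2 = Real.exp (2 * Real.log X) := by
    rw [show (2 : ℝ) * Real.log X = ((2 : ℕ) : ℝ) * Real.log X by norm_num, Real.exp_nat_mul,
      Real.exp_log hX0]
  have h1 : Real.exp (Real.log X * β) ^ 2 =
      Real.exp (2 * Real.log X) * Real.exp (-(2 * Real.log X * (1 - β))) := by
    rw [sq, ← Real.exp_add, ← Real.exp_add]
    congr 1
    ring
  rw [h1, hX2]
  have h2 : 1 - t ≤ Real.exp (-(2 * Real.log X * (1 - β))) := by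
    have := Real.add_one_le_exp (-(2 * Real.log X * (1 - β)))
    linarith
  have h3 : 0 < Real.exp (2 * Real.log X) := Real.exp_pos _
  nlinarith

/-! ### The numerical estimates of Steps 3–6, isolated -/

/-- Step 2, the hypothesis of (11.29) modulo `2q`: `1 − c'/(3 log q) < β`, `c' ≤ c`, `q ≥ 3`
give `1 − c/log(4·2q) < β` (as `log 8q ≤ 3 log q`). [folklore] -/
theorem one_sub_div_log_lt {c c' β : ℝ} {q : ℕ} (hc'0 : 0 < c') (hc'c : c' ≤ c)
    (hq3 : (3 : ℝ) ≤ q) (hβ : 1 - c' / 3 / Real.log q < β) :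
    1 - c / Real.log (4 * ((2 * q : ℕ) : ℝ)) < β := by
  have hq0 : (0 : ℝ) < q := by linarith
  have hlogq0 : 0 < Real.log q := Real.log_pos (by linarith)
  have h8 : Real.log (4 * ((2 * q : ℕ) : ℝ)) = Real.log 8 + Real.log q := by
    push_cast
    rw [show (4 : ℝ) * (2 * q) = 8 * q by ring, Real.log_mul (by norm_num) hq0.ne']
  have h8le : Real.log 8 ≤ 2 * Real.log q := by
    have h := Real.log_le_log (by norm_num : (0 : ℝ) < 8) (by nlinarith : (8 : ℝ) ≤ q ^ 2)
    rw [Real.log_pow] at h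
    push_cast at h
    linarith
  have hlog8q : 0 < Real.log 8 + Real.log q := by
    have : 0 < Real.log 8 := Real.log_pos (by norm_num)
    linarith
  have h1 : c' / 3 / Real.log q ≤ c / (Real.log 8 + Real.log q) := by
    rw [div_le_div_iff₀ hlogq0 hlog8q]
    nlinarith
  rw [h8]
  linarith

/-- Step 3, the error term: if `(2 log q/c₁)² ≤ log X` then `e^{−c₁√log X} ≤ q^{−2}`.
[cite: GoldstonSuriajaya2021, §5 (choice of N)] -/
theorem exp_neg_mul_sqrt_log_le {c₁ q L : ℝ} (hc₁ : 0 < c₁) (hq1 : 1 ≤ q) (hL0 : 0 ≤ L)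
    (hL : (2 * Real.log q / c₁) ^ 2 ≤ L) :
    Real.exp (-c₁ * Real.sqrt L) ≤ 1 / q ^ 2 := by
  have hq0 : 0 < q := by linarith
  have hlogq : 0 ≤ Real.log q := Real.log_nonneg hq1
  have h1 : 2 * Real.log q / c₁ ≤ Real.sqrt L := by
    rw [Real.le_sqrt (by positivity) hL0]
    exact hL
  have h2 : -c₁ * Real.sqrt L ≤ -(2 * Real.log q) := by
    have := mul_le_mul_of_nonneg_left h1 hc₁.le
    rw [mul_div_cancel₀ _ hc₁.ne'] at this
    linarith
  calc Real.exp (-c₁ * Real.sqrt L) ≤ Real.exp (-(2 * Real.log q)) := Real.exp_le_exp.mpr h2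
    _ = 1 / q ^ 2 := by
        rw [Real.exp_neg, show (2 : ℝ) * Real.log q = ((2 : ℕ) : ℝ) * Real.log q by norm_num,
          Real.exp_nat_mul, Real.exp_log hq0, one_div]

/-- Step 4, the exceptional main term: `(1 − δ/4)X²/Φ ≤ Φ S²` for `S = X^β/(Φβ)`, `0 < β < 1`,
once `2 log X (1 − β) ≤ δ/4`. [cite: GoldstonSuriajaya2021, §5 (key)] -/
theorem excTerm_ge {X Φ β δ S : ℝ} (hX1 : 1 ≤ X) (hΦ0 : 0 < Φ) (hβ0 : 0 < β) (hβ1 : β < 1)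
    (hexc : 2 * Real.log X * (1 - β) ≤ δ / 4) (hSdef : S = X ^ β / (Φ * β)) :
    (1 - δ / 4) * (X ^ 2 / Φ) ≤ Φ * S ^ 2 := by
  have hX0 : 0 < X := by linarith
  have h1 := rpow_sq_ge hX1 hexc
  have h2 : Φ * S ^ 2 = (X ^ β) ^ 2 / Φ * (1 / β ^ 2) := by
    rw [hSdef]
    field_simp
  have h3 : 1 ≤ 1 / β ^ 2 := by
    rw [le_div_iff₀ (by positivity), one_mul]
    exact pow_le_one₀ hβ0.le hβ1.le
  have h4 : 0 ≤ (X ^ β) ^ 2 / Φ := by positivity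
  rw [h2]
  calc (1 - δ / 4) * (X ^ 2 / Φ) = (1 - δ / 4) * X ^ 2 / Φ * 1 := by ring
    _ ≤ (X ^ β) ^ 2 / Φ * (1 / β ^ 2) :=
        mul_le_mul (div_le_div_of_nonneg_right h1 hΦ0.le) h3 zero_le_one h4

/-- Step 4, the error terms: `2Φ(M + S)E ≤ (δ/4)X²/Φ` for `M = X/Φ`, `S = X^β/(Φβ)`,
`E ≤ KX/q²`, `Φ ≤ 2q`, `48K < δq`, `2/3 < β ≤ 1`. [cite: GoldstonSuriajaya2021, §4 (Sq4)] -/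
theorem errTerm_le {X Φ β δ K q M S E : ℝ} (hX1 : 1 ≤ X) (hΦ0 : 0 < Φ) (hΦle : Φ ≤ 2 * q)
    (hq0 : 0 < q) (hK : 0 < K) (hKq : 48 * K < δ * q) (hβ23 : 2 / 3 < β) (hβ1 : β ≤ 1)
    (hMdef : M = X / Φ) (hSdef : S = X ^ β / (Φ * β)) (hE0 : 0 ≤ E)
    (hE : E ≤ K * X * (1 / q ^ 2)) :
    2 * ((M + S) * E) * Φ ≤ δ / 4 * (X ^ 2 / Φ) := by
  have hX0 : 0 < X := by linarith
  have hβ0 : 0 < β := by linarith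
  have hXβ : X ^ β ≤ X := by
    calc X ^ β ≤ X ^ (1 : ℝ) := Real.rpow_le_rpow_of_exponent_le hX1 hβ1
      _ = X := Real.rpow_one _
  -- `Φ(M + S) ≤ 3X`
  have h1 : (M + S) * Φ ≤ 3 * X := by
    have hS' : S * Φ = X ^ β / β := by
      rw [hSdef]
      field_simp
    have hM' : M * Φ = X := by
      rw [hMdef]
      field_simp
    have h2 : X ^ β / β ≤ 2 * X := by
      rw [div_le_iff₀ hβ0]
      have : X * (2 / 3) ≤ X * β := mul_le_mul_of_nonneg_left hβ23.le hX0.le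
      linarith
    have : (M + S) * Φ = M * Φ + S * Φ := by ring
    linarith
  have hMS0 : 0 ≤ (M + S) * Φ := by
    have : 0 ≤ M := hMdef ▸ by positivity
    have : 0 ≤ S := hSdef ▸ by positivity
    positivity
  have h3 : 2 * ((M + S) * E) * Φ ≤ 6 * X * (K * X * (1 / q ^ 2)) := by
    have h := mul_le_mul h1 hE hE0 (by positivity)
    have : 2 * ((M + S) * E) * Φ = 2 * ((M + S) * Φ * E) := by ring
    linarith
  have h4 : 6 * K / q ^ 2 ≤ δ / (4 * Φ) := by
    rw [div_le_div_iff₀ (by positivity) (by positivity)]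
    have h5 : 24 * K * Φ ≤ 24 * K * (2 * q) := mul_le_mul_of_nonneg_left hΦle (by positivity)
    have h6 : 48 * K * q < δ * q * q := mul_lt_mul_of_pos_right hKq hq0
    nlinarith
  have h5 : 6 * X * (K * X * (1 / q ^ 2)) = X ^ 2 * (6 * K / q ^ 2) := by ring
  have h6 : δ / 4 * (X ^ 2 / Φ) = X ^ 2 * (δ / (4 * Φ)) := by ring
  rw [h6]
  rw [h5] at h3
  exact h3.trans (mul_le_mul_of_nonneg_left h4 (by positivity))

/-- Step 5, the diagonal: `(X + 1)log²X ≤ (δ/4)X²/Φ` once `√X ≥ q²`, `Φ ≤ 2q`, `256 < δq`.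
[cite: GoldstonSuriajaya2021, §7 (Psi_2(r,0))] -/
theorem diagTerm_le {X Φ δ q : ℝ} (hX1 : 1 ≤ X) (hΦ0 : 0 < Φ) (hΦle : Φ ≤ 2 * q) (hδ : 0 < δ)
    (h256q : 256 < δ * q) (hsqrtX : q ^ 2 ≤ Real.sqrt X) :
    (X + 1) * Real.log X ^ 2 ≤ δ / 4 * (X ^ 2 / Φ) := by
  have hX0 : 0 < X := by linarith
  have hq0 : 0 < q := by linarith
  refine (add_one_mul_log_sq_le hX1).trans ?_
  have hXX : Real.sqrt X * Real.sqrt X = X := Real.mul_self_sqrt hX0.le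
  have h1 : 128 * Φ ≤ δ * Real.sqrt X := by
    have h2 : 256 * q ≤ δ * q * q := by nlinarith
    calc 128 * Φ ≤ 256 * q := by linarith
      _ ≤ δ * q * q := h2
      _ = δ * q ^ 2 := by ring
      _ ≤ δ * Real.sqrt X := mul_le_mul_of_nonneg_left hsqrtX hδ.le
  have hs0 : 0 ≤ X * Real.sqrt X := by positivity
  have h2 : 128 * Φ * (X * Real.sqrt X) ≤ δ * Real.sqrt X * (X * Real.sqrt X) :=
    mul_le_mul_of_nonneg_right h1 hs0
  have h3 : Real.sqrt X * (X * Real.sqrt X) = X ^ 2 := by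
    rw [mul_left_comm, hXX, sq]
  have h6 : δ / 4 * (X ^ 2 / Φ) = δ * X ^ 2 / (4 * Φ) := by ring
  rw [h6, le_div_iff₀ (by positivity)]
  calc 32 * X * Real.sqrt X * (4 * Φ) = 128 * Φ * (X * Real.sqrt X) := by ring
    _ ≤ δ * Real.sqrt X * (X * Real.sqrt X) := h2
    _ = δ * X ^ 2 := by rw [mul_assoc, h3]

/-- Step 6, the bookkeeping: the two evaluations are incompatible. [cite: GoldstonSuriajaya2021, §5 (key)] -/
theorem final_contradiction {T D P Φ M S E δ : ℝ}
    (hLB : Φ * (M ^ 2 + S ^ 2 - 2 * ((M + S) * E)) ≤ T)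
    (hUB : T ≤ D + (2 - δ + 2 * (δ / 16)) * P)
    (hMM : Φ * M ^ 2 = P) (hSS : (1 - δ / 4) * P ≤ Φ * S ^ 2)
    (hEE : 2 * ((M + S) * E) * Φ ≤ δ / 4 * P) (hDD : D ≤ δ / 4 * P) (hδP : 0 < δ * P) :
    False := by
  have h1 : Φ * (M ^ 2 + S ^ 2 - 2 * ((M + S) * E)) =
      Φ * M ^ 2 + Φ * S ^ 2 - 2 * ((M + S) * E) * Φ := by ring
  rw [h1] at hLB
  linarith

/-! ### Steps 3–6: Goldston–Suriajaya's Theorem 2 from (11.29) -/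

/-- **Goldston–Suriajaya 2021, Theorem 2, proved from Montgomery–Vaughan (11.29).** The named
fact `Literature.NumberTheory.LFunctions.PagePNTWithExceptionalZero` (the prime number theorem for
progressions with the exceptional-zero term, GS21's input (PNTAP)) implies the barrier
`SiegelZeroPrimePairBarrier`: the Hardy–Littlewood Prime-Pair Upper Bound Conjecture with
constant `2 − δ` forces `β < 1 − C(δ)/log²q` for every real zero `β > 1 − c/log q` of a real
`L(s, χ)` mod `q`, `q ≥ q₀(δ)`. See the module docstring for the argument (GS21 §§4–7 with a
sharp cutoff). [cite: GoldstonSuriajaya2021, Theorem 2 and §7] -/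
theorem _root_.Literature.Barriers.Parity.SiegelZeroPrimePairBarrier_of_pagePNT
    (hP : PagePNTWithExceptionalZero) : SiegelZeroPrimePairBarrier := by
  obtain ⟨c, hc, c₁, hc₁, K, hK, hP⟩ := hP
  -- the absolute constant of the barrier: `c'/3`, `c' = min(c, 1)`
  obtain ⟨c', hc'def⟩ : ∃ c' : ℝ, c' = min c 1 := ⟨_, rfl⟩
  have hc'0 : 0 < c' := hc'def ▸ lt_min hc one_pos
  have hc'c : c' ≤ c := hc'def ▸ min_le_left _ _
  have hc'1 : c' ≤ 1 := hc'def ▸ min_le_right _ _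
  refine ⟨c' / 3, by positivity, fun δ hδ hδ1 hconj => ?_⟩
  -- constants depending on `δ`
  obtain ⟨A, hAdef⟩ : ∃ A : ℝ, A = 4 / c₁ ^ 2 := ⟨_, rfl⟩
  have hA0 : 0 < A := hAdef ▸ by positivity
  obtain ⟨C, hCdef⟩ : ∃ C : ℝ, C = δ / (8 * (A + 5)) := ⟨_, rfl⟩
  have hC0 : 0 < C := hCdef ▸ by positivity
  have hη0 : (0 : ℝ) ≤ δ / 16 := by positivity
  have hδ2 : δ ≤ 2 := by linarith
  obtain ⟨x₀, hx₀⟩ := hconj (δ / 16) (by positivity)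
  obtain ⟨Y, hYdef⟩ : ∃ Y : ℝ, Y = max (max 3 x₀) (max (48 * K / δ) (256 / δ)) := ⟨_, rfl⟩
  refine ⟨C, hC0, ⌈Y⌉₊ + 1, fun q _ hq χ hχ β hβ hβ1 hL => ?_⟩
  -- `q` is large
  have hqY : Y < q := by
    have h1 : (Y : ℝ) ≤ ⌈Y⌉₊ := Nat.le_ceil Y
    have h2 : ((⌈Y⌉₊ + 1 : ℕ) : ℝ) ≤ q := by exact_mod_cast hq
    push_cast at h2
    linarith
  have hq3 : (3 : ℝ) < q :=
    lt_of_le_of_lt (hYdef ▸ (le_max_left _ _).trans (le_max_left _ _)) hqY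
  have hqx₀ : x₀ < q :=
    lt_of_le_of_lt (hYdef ▸ (le_max_right _ _).trans (le_max_left _ _)) hqY
  have hqK : 48 * K / δ < q :=
    lt_of_le_of_lt (hYdef ▸ (le_max_left _ _).trans (le_max_right _ _)) hqY
  have hq256 : 256 / δ < q :=
    lt_of_le_of_lt (hYdef ▸ (le_max_right _ _).trans (le_max_right _ _)) hqY
  have hq4 : 4 ≤ q := by
    have : (3 : ℕ) < q := by exact_mod_cast hq3
    omega
  have hq0 : (0 : ℝ) < q := by linarith
  have hq1 : (1 : ℝ) < q := by linarith
  have hlog4 : (1 : ℝ) < Real.log 4 := by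
    rw [show (4 : ℝ) = 2 ^ 2 by norm_num, Real.log_pow]
    have := Real.log_two_gt_d9
    push_cast
    linarith
  have hlogq : 1 < Real.log q :=
    hlog4.trans_le (Real.log_le_log (by norm_num) (by exact_mod_cast hq4))
  have hlogq0 : 0 < Real.log q := by linarith
  have hKq : 48 * K < δ * q := by
    have := (div_lt_iff₀ hδ).mp hqK
    linarith
  have h256q : 256 < δ * q := by
    have := (div_lt_iff₀ hδ).mp hq256
    linarith
  -- `β` is close to `1`
  have hβ23 : 2 / 3 < β := by
    have h1 : c' / 3 / Real.log q ≤ 1 / 3 := by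
      rw [div_le_iff₀ hlogq0]
      nlinarith
    linarith
  have hβ0 : 0 < β := by linarith
  by_contra hcon
  rw [not_lt] at hcon
  -- Step 1: `χ ≠ χ₀`
  have hχ1 : χ ≠ 1 := by
    rintro rfl
    exact LFunction_one_ne_zero_of_pos_of_lt_one q hβ0 hβ1 hL
  -- Step 2: the even modulus `q' = 2q` and the induced character
  have hdvd : q ∣ 2 * q := Dvd.intro_left 2 rfl
  have hχ'1 : DirichletCharacter.changeLevel hdvd χ ≠ 1 := fun h =>
    hχ1 ((DirichletCharacter.changeLevel_eq_one_iff hdvd).mp h)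
  have hχ'q : (DirichletCharacter.changeLevel hdvd χ).IsQuadratic := by
    -- a character induced from a quadratic character is quadratic
    -- (cf. `Literature.Barriers.RiemannHypothesis.isQuadratic_changeLevel`)
    intro b
    by_cases hb : IsUnit b
    · obtain ⟨u, rfl⟩ := hb
      rw [DirichletCharacter.changeLevel_eq_cast_of_dvd χ hdvd u]
      exact hχ _
    · exact Or.inl (MulChar.map_nonunit _ hb)
  have hL' : (DirichletCharacter.changeLevel hdvd χ).LFunction β = 0 := by
    rw [DirichletCharacter.LFunction_changeLevel hdvd χ (Or.inl hχ1), hL, zero_mul]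
  have hβ' : 1 - c / Real.log (4 * ((2 * q : ℕ) : ℝ)) < β :=
    one_sub_div_log_lt hc'0 hc'c hq3.le hβ
  -- Step 3: the length `X = q^m`
  obtain ⟨m, hmdef⟩ : ∃ m : ℕ, m = ⌈A * Real.log q⌉₊ + 4 := ⟨_, rfl⟩
  have hm4 : 4 ≤ m := hmdef ▸ Nat.le_add_left 4 _
  have hmA : A * Real.log q ≤ m := by
    have := Nat.le_ceil (A * Real.log q)
    rw [hmdef]
    push_cast
    linarith
  have hmA' : (m : ℝ) ≤ A * Real.log q + 5 := by
    have := Nat.ceil_lt_add_one (by positivity : 0 ≤ A * Real.log q)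
    rw [hmdef]
    push_cast
    linarith
  obtain ⟨X, hXdef⟩ : ∃ X : ℕ, X = q ^ m := ⟨_, rfl⟩
  have hXR : (X : ℝ) = (q : ℝ) ^ m := by rw [hXdef, Nat.cast_pow]
  have hX4 : (q : ℝ) ^ 4 ≤ (X : ℝ) := by
    rw [hXR]
    exact pow_le_pow_right₀ hq1.le hm4
  have hXq : (q : ℝ) ≤ (X : ℝ) := by
    calc (q : ℝ) = (q : ℝ) ^ 1 := (pow_one _).symm
      _ ≤ (q : ℝ) ^ 4 := pow_le_pow_right₀ hq1.le (by norm_num)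
      _ ≤ (X : ℝ) := hX4
  have hX1 : (1 : ℝ) ≤ (X : ℝ) := by linarith
  have hX0 : (0 : ℝ) < (X : ℝ) := by linarith
  have hX2 : (2 : ℝ) ≤ (X : ℝ) := by linarith
  have hXx₀ : x₀ ≤ (X : ℝ) := by linarith
  have hlogX : Real.log X = m * Real.log q := by rw [hXR, Real.log_pow]
  have hlogX0 : 0 ≤ Real.log X := Real.log_nonneg hX1
  -- `√X ≥ q²`
  have hsqrtX : (q : ℝ) ^ 2 ≤ Real.sqrt X := by
    rw [Real.le_sqrt (by positivity) hX0.le]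
    calc ((q : ℝ) ^ 2) ^ 2 = (q : ℝ) ^ 4 := by ring
      _ ≤ (X : ℝ) := hX4
  -- `e^{-c₁√log X} ≤ q^{-2}`
  have hexp : Real.exp (-c₁ * Real.sqrt (Real.log X)) ≤ 1 / (q : ℝ) ^ 2 := by
    refine exp_neg_mul_sqrt_log_le hc₁ hq1.le hlogX0 ?_
    calc (2 * Real.log q / c₁) ^ 2 = A * Real.log q * Real.log q := by
          rw [hAdef]
          field_simp
          ring
      _ ≤ m * Real.log q := mul_le_mul_of_nonneg_right hmA hlogq0.le
      _ = Real.log X := hlogX.symm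
  -- `2(1 − β) log X ≤ δ/4`
  have hexc : 2 * Real.log X * (1 - β) ≤ δ / 4 := by
    have h1 : 1 - β ≤ C / Real.log q ^ 2 := by linarith
    have h2 : (m : ℝ) / Real.log q ≤ A + 5 := by
      rw [div_le_iff₀ hlogq0]
      nlinarith
    calc 2 * Real.log X * (1 - β) ≤ 2 * Real.log X * (C / Real.log q ^ 2) :=
          mul_le_mul_of_nonneg_left h1 (by positivity)
      _ = 2 * C * (m / Real.log q) := by
          rw [hlogX]
          field_simp
      _ ≤ 2 * C * (A + 5) := mul_le_mul_of_nonneg_left h2 (by positivity)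
      _ = δ / 4 := by
          rw [hCdef]
          field_simp
          ring
  -- the even modulus and its totient `Φ`
  have hq'0 : (2 * q : ℕ) ≠ 0 := by positivity
  obtain ⟨Φ, hΦdef⟩ : ∃ Φ : ℝ, Φ = (Nat.totient (2 * q) : ℝ) := ⟨_, rfl⟩
  have hΦ0 : 0 < Φ := by
    rw [hΦdef]
    exact_mod_cast Nat.totient_pos.mpr (Nat.pos_of_ne_zero hq'0)
  have hΦle : Φ ≤ 2 * q := by
    rw [hΦdef]
    exact_mod_cast Nat.totient_le (2 * q)
  -- the main terms `M = X/Φ`, `S = X^β/(Φβ)` and the error `E = KXe^{-c₁√log X}`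
  obtain ⟨M, hMdef⟩ : ∃ M : ℝ, M = (X : ℝ) / Φ := ⟨_, rfl⟩
  obtain ⟨S, hSdef⟩ : ∃ S : ℝ, S = (X : ℝ) ^ β / (Φ * β) := ⟨_, rfl⟩
  obtain ⟨E, hEdef⟩ : ∃ E : ℝ, E = K * X * Real.exp (-c₁ * Real.sqrt (Real.log X)) := ⟨_, rfl⟩
  have hM0 : 0 ≤ M := hMdef ▸ by positivity
  have hXβ0 : 0 ≤ (X : ℝ) ^ β := by positivity
  have hS0 : 0 ≤ S := hSdef ▸ by positivity
  have hE0 : 0 ≤ E := hEdef ▸ by positivity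
  have hE : E ≤ K * X * (1 / (q : ℝ) ^ 2) := by
    rw [hEdef]
    exact mul_le_mul_of_nonneg_left hexp (by positivity)
  -- the four estimates
  have hMM : Φ * M ^ 2 = (X : ℝ) ^ 2 / Φ := by
    rw [hMdef]
    field_simp
  have hSS : (1 - δ / 4) * ((X : ℝ) ^ 2 / Φ) ≤ Φ * S ^ 2 := excTerm_ge hX1 hΦ0 hβ0 hβ1 hexc hSdef
  have hEE : 2 * ((M + S) * E) * Φ ≤ δ / 4 * ((X : ℝ) ^ 2 / Φ) :=
    errTerm_le hX1 hΦ0 hΦle hq0 hK hKq hβ23 hβ1.le hMdef hSdef hE0 hE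
  have hDD : ((X : ℝ) + 1) * Real.log X ^ 2 ≤ δ / 4 * ((X : ℝ) ^ 2 / Φ) :=
    diagTerm_le hX1 hΦ0 hΦle hδ h256q hsqrtX
  have hδP : 0 < δ * ((X : ℝ) ^ 2 / Φ) := by positivity
  -- Step 5: the first evaluation (upper bound) from the conjecture
  have hUB : residueSquareSum (2 * q) X ≤
      ((X : ℝ) + 1) * Real.log X ^ 2 + (2 - δ + 2 * (δ / 16)) * ((X : ℝ) ^ 2 / Φ) := by
    rw [hΦdef, ← mul_div_assoc]
    refine residueSquareSum_le (even_two_mul q) hδ2 hη0 fun k hk h2k hkX => ?_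
    exact hx₀ X hXx₀ k hk h2k (by exact_mod_cast hkX)
  -- Step 4: the second evaluation (lower bound) from (11.29) modulo `2q`
  have hLB : Φ * (M ^ 2 + S ^ 2 - 2 * ((M + S) * E)) ≤ residueSquareSum (2 * q) X := by
    rw [hΦdef]
    refine residueSquareSum_ge hχ'1 hχ'q X hM0 hS0 fun b hb => ?_
    have h := hP (2 * q) (DirichletCharacter.changeLevel hdvd χ) hχ'1 hχ'q β hβ' hβ1 hL' b hb X hX2
    rw [mul_div_assoc, ← hΦdef, ← hMdef, ← hSdef, ← hEdef] at h
    exact h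
  -- Step 6: contradiction
  exact final_contradiction hLB hUB hMM hSS hEE hDD hδP

end GoldstonSuriajaya

end Literature.Barriers.Parity
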